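import Summits.QuantumFields.BalabanUV.Beta.D1BFx.PackedDressingBridge
import Summits.QuantumFields.BalabanUV.Beta.AxialDressingRootedHessian
import Summits.QuantumFields.BalabanUV.Beta.SymmetrisedDressingLinear

/-!
# `BalabanUV.Beta.D1BFx.PackedDressingBridgeComb` — road «BF-x» for binder row D1, slot (K), junction (J1) after «(J1-γ) ABSORPTION»: brick
# «PACK-BRIDGE (III′)» — **THE SECOND-ORDER PACK-BRIDGES OF THE OWNER's `PackedDressingBridge` TWINNED FOR THE TWO PROJECTORS OF THE LITERAL OF
# RECORD's DRESSING, the ROOTED AXIAL COMB `Πᵀ_ρ` (`coDressKAt ∕ coProjAtK`) and the SYMMETRISED BLOCK-MEAN COMB `Π̂ᵀ_sbm` (`coDressKSymAt ∕ coProjSymAtK`)**: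
# for a decaying `K` and a `LocStencil₂` pair family `S₂`,
# `vertex2OfK (coDressKAt ρ N K) N S₂ = vertex2OfK K N S₂^{ΠΠ}` and `vertex2OfK (coDressKSymAt ρ N K) N S₂ = vertex2OfK K N S₂^{Π̂Π̂}` (both bond indices dressed,
# the resolvent undressed), together with the first-order bridges in ENTRYWISE-BOUNDED form and the commutation of the outer projector with the inner vertex.

WHY (OWNER d1-p2 g21 `J1-RESIDUE-SPEC.md` v0.1 S6′, journal F-g21-2 l.46566 ∕ an2 g42 RULING R-D1-g42-3 l.46622): after absorption the literal's leg is
`GcombSh n 0 = coDressKAt ρc (coDressKSymAt ρc G₀^{bm})`; to let the literal's bi-vertex word `vertex2OfK (GcombSh n 0) n (T2RecOf … 0)` flow through the road's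
second-order slot `vertex2OfK G₀^{bm} n (S₂ n)` one needs «the (III′) analogues of `PackedDressingBridge.vertex2OfK_coDressKBmAt_eq_full` … typed for `piK` ∕
`piKSymBm` (pattern identical; natural lane: leaf-03 ∕ gan24-leaf-05)» (S6′).  THIS FILE is that pattern, verbatim, over an2's rooted∕symmetrised letters
(`AxialDressingRootedHessian.sum_tsum_mul_coProjAt ∕ colH_coDressKAt_eq`, `AxialDressingRootedLinear.decays_coDressKAt`, `AxialDressingRooted.abs_coProjAt_le`;
`SymmetrisedDressingLinear.sum_tsum_mul_coProjSymAt ∕ colH_coDressKSymAt_eq`, `SymmetrisedDressingKernel.decays_coDressKSymAt`, `SymmetrisedDressingLegs.abs_coProjSymAt_le`)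
and the Literature's `SecondOrderResponse.biLoc_vertexOfK_slice`; the OWNER's generic `bdd_of_locStencil₂ ∕ abs_le_of_locStencil₂` BY NAME.

CONTENT (all [folklore]; `ρ := toSite r`, `r ∈ box (d+1) N` an in-block root, every `d`):
* §1 ROOTED AXIAL COMB `Πᵀ_ρ`: `vertexOfK_coDressKAt_eq` (first order, entrywise-bounded family), `vertex2OfK_coDressKAt_eq` (inner then outer slot),
  `coProjAtK_vertexOfK_comm` (`Πᵀ_ρ` on the OUTER index commutes with the inner chain-rule vertex), **`vertex2OfK_coDressKAt_eq_full`**.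
* §2 SYMMETRISED BLOCK-MEAN COMB `Π̂ᵀ_sbm`: `vertexOfK_coDressKSymAt_eq`, `vertex2OfK_coDressKSymAt_eq`, `coProjSymAtK_vertexOfK_comm`, **`vertex2OfK_coDressKSymAt_eq_full`**.
NOT HERE: the composite at `GcombSh n 0` (= §1 after §2, needs the `LocStencil₂` transport of the pair family through `coProjAtK` on both slots — gan24's
`LinT2CoDressed.locStencil₂_dress` pattern for `Π_bm`; a sequel), the first-order `LocStencil` forms (IN TREE: `AxialDressingRootedHessian.vertexOfK_coProjAtK`,
`SymmetrisedDressingLinear.vertexOfK_coProjSymAtK`), any statement about the literal's tables.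

HONEST DEPENDENCY (cell records, verbatim): «continuum YM on T⁴ ⇐ BetaPertH ∧ nine spine estimates (0/9 proved); BetaPertH ⇐ (D1) ∧ (D4) ∧
CAP+tail; G-an2-4 gates asym, D1 and NE2/3/4.»  HONEST FRAMING (cell contract, verbatim): «discharging `BetaPertH` makes Bałaban's UV stability
UNCONDITIONAL — a real constructive-QFT result; it is NOT the continuum limit and NOT the Clay problem.»  THIS MODULE DISCHARGES NOTHING of (K),
of D1 or of the wall: [folklore] `ℓ¹` bookkeeping BY NAME (finite window sums through absolutely convergent superpositions).  No definition, no
`def … : Prop`, nothing cited, 0 sorry.  0 root-level binders of row D1 discharged (hW ∕ hR ∕ D1Tel ∕ D1Rep); the «(J1-W) tadpole row» stays OPEN;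
(K) NOT closed; NOT D1, NOT `BetaPertH`, NOT continuum, NOT Clay.

ABSOLUTE RULE (cell charter, verbatim): «No internally-minted statement may enter as a cited fact. Every hypothesis is either kernel-proved in this
package or a verbatim quotation of a PUBLISHED theorem with page reference. The manuscript(s) under audit are NOT citable for their own disputed
steps — they are the thing under adjudication; programme-internal (2001/route/tribunal) claims are never citable.»
Unit `b2b-balaban-beta-d1-formalise-leaf-03` (gen 27), D1 formalisation swarm leaf prover 03, road «BF-x»; OWNER spec S6′ (journal [D1LEAF03-G27-*]).
-/

noncomputable section

namespace Summit.QuantumFields.BalabanUV.Beta.D1BFx.PackedDressingBridgeComb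

open scoped BigOperators
open Literature.MathematicalPhysics.QuantumFieldTheory.Balaban1983to89
open Literature.MathematicalPhysics.QuantumFieldTheory.Balaban1983to89.Beta
open B12Sec2to5 (l1 l1_nonneg)
open ExpKernelCalculus (MKer BiLoc Decays Zl Zl_nonneg)
open AffineAveraging (box toSite)
open OneStepResolventKernel (Fib wsum LocStencil)
open OneStepKernelFamily (colH vertexOfK)
open BalabanCompositeJets (LocStencil₂)
open SecondOrderResponse (vertex2OfK biLoc_vertexOfK_slice)
open Summit.QuantumFields.BalabanUV.Beta.TameKernelCalculus (decays_of_le)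
open Summit.QuantumFields.BalabanUV.Beta.AxialDressingRooted (pm cube cW cWb coProjAt coProjAtK coProjW coDressKAt abs_coProjAt_le decays_coDressKAt
  colH_coDressKAt_eq sum_tsum_mul_coProjAt)
open Summit.QuantumFields.BalabanUV.Beta.SymmetrisedDressingMatrix (pmSymBm)
open Summit.QuantumFields.BalabanUV.Beta.SymmetrisedDressingLegs (coProjSymAt abs_coProjSymAt_le)
open Summit.QuantumFields.BalabanUV.Beta.SymmetrisedDressingDress (coProjSymAtK)
open Summit.QuantumFields.BalabanUV.Beta.SymmetrisedDressingKernel (coDressKSymAt decays_coDressKSymAt)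
open Summit.QuantumFields.BalabanUV.Beta.SymmetrisedDressingLinear (coProjSymW colH_coDressKSymAt_eq sum_tsum_mul_coProjSymAt)
open Summit.QuantumFields.BalabanUV.Beta.D1BFx.PackedDressingBridge (bdd_of_locStencil₂ abs_le_of_locStencil₂)

variable {d : ℕ}

/-! ## §1 The rooted axial comb `Πᵀ_ρ` -/

section Rooted

variable {N : ℕ} (hN : 1 ≤ N) {r : Fin (d + 1) → ℕ} (hr : r ∈ box (d + 1) N)
include hN hr

/-- [folklore] **PACK BRIDGE, FIRST ORDER, ROOTED COMB** (entrywise-bounded family): for a decaying `K` and a bond family `S` with entrywise-bounded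
members, `vertexOfK (coDressKAt ρ N K) N S μ y = vertexOfK K N (coProjAtK ρ N S) μ y` — packing the UNDRESSED stencils with the `ℋ`-columns of the rooted
co-dressed kernel (`colH (coDressKAt ρ N K) = coProjW ρ N ∘ colH K`) IS packing the `Πᵀ_ρ`-dressed stencils with `K`'s own columns (`sum_tsum_mul_coProjAt`). -/
theorem vertexOfK_coDressKAt_eq {K : MKer (d + 1) (Fib d)} {C δ : ℝ} (hK : Decays K C δ) (hδ : 0 < δ)
    (S : Fin (d + 1) → (Fin (d + 1) → ℤ) → MKer (d + 1) (Fib d)) (hSb : ∀ x z a b, ∃ M : ℝ, ∀ κ u, |S κ u x z a b| ≤ M)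
    (μ : Fin (d + 1)) (y : Fin (d + 1) → ℤ) :
    vertexOfK (coDressKAt (toSite r) N K) N S μ y = vertexOfK K N (coProjAtK (toSite r) N S) μ y := by
  funext x z a b
  obtain ⟨M, hM⟩ := hSb x z a b
  have hA : ∀ κ : Fin (d + 1), Summable (colH K N μ y κ) :=
    fun κ => AxialDressing.summable_col_of_decays hK hδ ((N : ℤ) • y) (Sum.inl κ) (Sum.inr μ)
  have h := sum_tsum_mul_coProjAt hN hr hA (g := fun κ u => S κ u x z a b) hM
  simp only [vertexOfK, wsum, coProjAtK, colH_coDressKAt_eq]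
  exact h.symm

/-- [folklore] **PACK BRIDGE, SECOND ORDER, ROOTED COMB** (inner then outer slot): for a decaying `K` and a `LocStencil₂` family,
`vertex2OfK (coDressKAt ρ N K) N S₂ μ y ν y′ = vertexOfK K N (coProjAtK ρ N (fun κ u => vertexOfK K N (coProjAtK ρ N (S₂ κ u)) ν y′)) μ y`. -/
theorem vertex2OfK_coDressKAt_eq {K : MKer (d + 1) (Fib d)} {C δ : ℝ} (hK : Decays K C δ) (hC : 0 ≤ C) (hδ : 0 < δ)
    {S₂ : Fin (d + 1) → (Fin (d + 1) → ℤ) → Fin (d + 1) → (Fin (d + 1) → ℤ) → MKer (d + 1) (Fib d)} {C₂ δ₂ : ℝ}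
    (hS₂ : LocStencil₂ S₂ C₂ δ₂) (hδ₂ : 0 < δ₂) (μ : Fin (d + 1)) (y : Fin (d + 1) → ℤ) (ν : Fin (d + 1)) (y' : Fin (d + 1) → ℤ) :
    vertex2OfK (coDressKAt (toSite r) N K) N S₂ μ y ν y'
      = vertexOfK K N (coProjAtK (toSite r) N (fun κ u => vertexOfK K N (coProjAtK (toSite r) N (S₂ κ u)) ν y')) μ y := by
  -- the inner slot, member by member
  have hin : ∀ κ u, vertexOfK (coDressKAt (toSite r) N K) N (S₂ κ u) ν y' = vertexOfK K N (coProjAtK (toSite r) N (S₂ κ u)) ν y' :=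
    fun κ u => vertexOfK_coDressKAt_eq hN hr hK hδ (S₂ κ u) (fun x z a b => bdd_of_locStencil₂ hS₂ hδ₂.le κ u x z a b) ν y'
  have e : (fun κ u => vertexOfK K N (coProjAtK (toSite r) N (S₂ κ u)) ν y')
      = fun κ u => vertexOfK (coDressKAt (toSite r) N K) N (S₂ κ u) ν y' := funext fun κ => funext fun u => (hin κ u).symm
  unfold vertex2OfK
  rw [e]
  -- the outer slot: the inner vertex family is entrywise bounded (`biLoc_vertexOfK_slice` through the decaying co-dressed kernel)
  refine vertexOfK_coDressKAt_eq hN hr hK hδ _ (fun x z a b => ?_) μ y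
  obtain ⟨δG, CG, hδG, hCG, hG⟩ := decays_coDressKAt hN hr ⟨δ, C, hδ, hC, hK⟩
  have hm : 0 < min δG δ₂ := lt_min hδG hδ₂
  have hG' : Decays (coDressKAt (toSite r) N K) (|CG|) (min δG δ₂) := decays_of_le hG (min_le_left _ _)
  have hS₂' : LocStencil₂ S₂ C₂ (min δG δ₂) := fun κ u κ' u' w w' a' b' => by
    refine (hS₂ κ u κ' u' w w' a' b').trans ?_
    have hC₂ := hS₂.nonneg
    rw [mul_assoc, mul_assoc, ← Real.exp_add, ← Real.exp_add]
    refine mul_le_mul_of_nonneg_left (Real.exp_le_exp.2 ?_) hC₂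
    have := min_le_right δG δ₂
    nlinarith [l1_nonneg (u' - u), l1_nonneg (w - u), l1_nonneg (w' - u)]
  refine ⟨(d + 1 : ℕ) * (|CG| * C₂ * Zl (d + 1) (min δG δ₂ / 2)), fun κ u => ?_⟩
  have h := biLoc_vertexOfK_slice (N := N) hG' (abs_nonneg _) hS₂' hm κ u ν y' x z a b
  refine h.trans ?_
  have hZ := Zl_nonneg (D := d + 1) (half_pos hm)
  have hC₂ := hS₂.nonneg
  have h1 : Real.exp (-(min δG δ₂ / 2) * l1 (u - (N : ℤ) • y')) ≤ 1 := Real.exp_le_one_iff.2 (by nlinarith [l1_nonneg (u - (N : ℤ) • y')])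
  have h2 : Real.exp (-(min δG δ₂) * (l1 (x - u) + l1 (z - u))) ≤ 1 := Real.exp_le_one_iff.2 (by nlinarith [l1_nonneg (x - u), l1_nonneg (z - u)])
  calc (d + 1 : ℕ) * (|CG| * C₂ * Zl (d + 1) (min δG δ₂ / 2) * Real.exp (-(min δG δ₂ / 2) * l1 (u - (N : ℤ) • y')))
        * Real.exp (-(min δG δ₂) * (l1 (x - u) + l1 (z - u)))
      ≤ (d + 1 : ℕ) * (|CG| * C₂ * Zl (d + 1) (min δG δ₂ / 2) * 1) * 1 :=
        mul_le_mul (mul_le_mul_of_nonneg_left (mul_le_mul_of_nonneg_left h1 (by positivity)) (by positivity)) h2 (Real.exp_pos _).le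
          (by positivity)
    _ = (d + 1 : ℕ) * (|CG| * C₂ * Zl (d + 1) (min δG δ₂ / 2)) := by ring

omit hN hr in
/-- [folklore] **`Πᵀ_ρ` ON THE OUTER INDEX COMMUTES WITH THE INNER CHAIN-RULE VERTEX**: for a decaying `K` and a two-bond family `T` entrywise bounded
uniformly in both bonds, `Πᵀ_ρ^{outer} (κ u ↦ vertexOfK K N (T κ u) ν y′) = (κ u ↦ vertexOfK K N (κ′ u′ ↦ Πᵀ_ρ^{outer} (T · · κ′ u′) κ u) ν y′)` (any root `ρ`;
the finite window sums pass through the absolutely convergent superposition). -/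
theorem coProjAtK_vertexOfK_comm (ρ : Fin (d + 1) → ℤ) {K : MKer (d + 1) (Fib d)} {C δ : ℝ} (hK : Decays K C δ) (hδ : 0 < δ)
    (T : Fin (d + 1) → (Fin (d + 1) → ℤ) → Fin (d + 1) → (Fin (d + 1) → ℤ) → MKer (d + 1) (Fib d))
    (hTb : ∀ x z a b, ∃ M : ℝ, ∀ κ₀ u₀ κ' u', |T κ₀ u₀ κ' u' x z a b| ≤ M) (ν : Fin (d + 1)) (y' : Fin (d + 1) → ℤ) :
    coProjAtK ρ N (fun κ u => vertexOfK K N (T κ u) ν y')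
      = fun κ u => vertexOfK K N (fun κ' u' => coProjAtK ρ N (fun κ₀ u₀ => T κ₀ u₀ κ' u') κ u) ν y' := by
  funext κ u x z a b
  obtain ⟨M, hM⟩ := hTb x z a b
  have hA : ∀ κ' : Fin (d + 1), Summable (colH K N ν y' κ') :=
    fun κ' => AxialDressing.summable_col_of_decays hK hδ ((N : ℤ) • y') (Sum.inl κ') (Sum.inr ν)
  have hs : ∀ (β : Fin (d + 1)) (w : Fin (d + 1) → ℤ) (κ' : Fin (d + 1)),
      Summable fun u' => colH K N ν y' κ' u' * T β w κ' u' x z a b := by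
    intro β w κ'
    refine Summable.of_norm_bounded (((hA κ').abs).mul_right |M|) (fun u' => ?_)
    rw [Real.norm_eq_abs, abs_mul]
    exact mul_le_mul_of_nonneg_left ((hM β w κ' u').trans (le_abs_self M)) (abs_nonneg _)
  show (∑ v ∈ cube (d + 1) N, ∑ β : Fin (d + 1), (pm ρ N β (u + v) κ u : ℝ)
          * ∑ κ' : Fin (d + 1), ∑' u' : Fin (d + 1) → ℤ, colH K N ν y' κ' u' * T β (u + v) κ' u' x z a b)
      = ∑ κ' : Fin (d + 1), ∑' u' : Fin (d + 1) → ℤ, colH K N ν y' κ' u'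
          * ∑ v ∈ cube (d + 1) N, ∑ β : Fin (d + 1), (pm ρ N β (u + v) κ u : ℝ) * T β (u + v) κ' u' x z a b
  have hR : ∀ κ' : Fin (d + 1), (∑' u' : Fin (d + 1) → ℤ, colH K N ν y' κ' u'
        * ∑ v ∈ cube (d + 1) N, ∑ β : Fin (d + 1), (pm ρ N β (u + v) κ u : ℝ) * T β (u + v) κ' u' x z a b)
      = ∑ v ∈ cube (d + 1) N, ∑ β : Fin (d + 1), (pm ρ N β (u + v) κ u : ℝ)
          * ∑' u' : Fin (d + 1) → ℤ, colH K N ν y' κ' u' * T β (u + v) κ' u' x z a b := by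
    intro κ'
    have e : ∀ u' : Fin (d + 1) → ℤ, colH K N ν y' κ' u'
          * ∑ v ∈ cube (d + 1) N, ∑ β : Fin (d + 1), (pm ρ N β (u + v) κ u : ℝ) * T β (u + v) κ' u' x z a b
        = ∑ v ∈ cube (d + 1) N, ∑ β : Fin (d + 1), (pm ρ N β (u + v) κ u : ℝ) * (colH K N ν y' κ' u' * T β (u + v) κ' u' x z a b) := by
      intro u'
      rw [Finset.mul_sum]
      refine Finset.sum_congr rfl fun v _ => ?_
      rw [Finset.mul_sum]
      exact Finset.sum_congr rfl fun β _ => by ring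
    simp_rw [e]
    rw [Summable.tsum_finsetSum (fun v _ => summable_sum fun β _ => (hs β (u + v) κ').mul_left _)]
    refine Finset.sum_congr rfl fun v _ => ?_
    rw [Summable.tsum_finsetSum (fun β _ => (hs β (u + v) κ').mul_left _)]
    exact Finset.sum_congr rfl fun β _ => tsum_mul_left
  simp_rw [hR]
  symm
  rw [Finset.sum_comm]
  refine Finset.sum_congr rfl fun v _ => ?_
  rw [Finset.sum_comm]
  refine Finset.sum_congr rfl fun β _ => ?_
  exact (Finset.mul_sum _ _ _).symm

/-- [folklore] **THE BI-VERTEX THROUGH A `Πᵀ_ρ`-DRESSED RESOLVENT, FULLY DRESSED FORM** (§ inner∕outer + `coProjAtK_vertexOfK_comm`): for a decaying `K` and a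
`LocStencil₂` pair family, `vertex2OfK (coDressKAt ρ N K) N S₂ = vertex2OfK K N S₂^{ΠΠ}`, `S₂^{ΠΠ} κ u κ′ u′ := Πᵀ_ρ^{outer} (κ₀ u₀ ↦ Πᵀ_ρ (S₂ κ₀ u₀) κ′ u′) κ u` —
BOTH bond indices dressed by the rooted axial comb, the resolvent undressed. -/
theorem vertex2OfK_coDressKAt_eq_full {K : MKer (d + 1) (Fib d)} {C δ : ℝ} (hK : Decays K C δ) (hC : 0 ≤ C) (hδ : 0 < δ)
    {S₂ : Fin (d + 1) → (Fin (d + 1) → ℤ) → Fin (d + 1) → (Fin (d + 1) → ℤ) → MKer (d + 1) (Fib d)} {C₂ δ₂ : ℝ}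
    (hS₂ : LocStencil₂ S₂ C₂ δ₂) (hδ₂ : 0 < δ₂) (μ : Fin (d + 1)) (y : Fin (d + 1) → ℤ) (ν : Fin (d + 1)) (y' : Fin (d + 1) → ℤ) :
    vertex2OfK (coDressKAt (toSite r) N K) N S₂ μ y ν y'
      = vertex2OfK K N (fun κ u κ' u' => coProjAtK (toSite r) N (fun κ₀ u₀ => coProjAtK (toSite r) N (S₂ κ₀ u₀) κ' u') κ u) μ y ν y' := by
  rw [vertex2OfK_coDressKAt_eq hN hr hK hC hδ hS₂ hδ₂ μ y ν y',
    coProjAtK_vertexOfK_comm (N := N) (toSite r) hK hδ (fun κ u κ' u' => coProjAtK (toSite r) N (S₂ κ u) κ' u') (fun x z a b => ?_) ν y']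
  · rfl
  · exact ⟨cW (d + 1) N * C₂, fun κ₀ u₀ κ' u' =>
      abs_coProjAt_le hN hr (fun κ₁ u₁ => S₂ κ₀ u₀ κ₁ u₁ x z a b) κ' u'
        (fun κ₁ v _ => abs_le_of_locStencil₂ hS₂ hδ₂.le κ₀ u₀ κ₁ (u' + v) x z a b)⟩

end Rooted

/-! ## §2 The symmetrised block-mean comb `Π̂ᵀ_sbm` -/

section Sym

variable {N : ℕ} (hN : 1 ≤ N) {r : Fin (d + 1) → ℕ} (hr : r ∈ box (d + 1) N)
include hN hr

/-- [folklore] **PACK BRIDGE, FIRST ORDER, SYMMETRISED COMB** (entrywise-bounded family): for a decaying `K` and a bond family `S` with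
entrywise-bounded members, `vertexOfK (coDressKSymAt ρ N K) N S μ y = vertexOfK K N (coProjSymAtK ρ N S) μ y` (`sum_tsum_mul_coProjSymAt`). -/
theorem vertexOfK_coDressKSymAt_eq {K : MKer (d + 1) (Fib d)} {C δ : ℝ} (hK : Decays K C δ) (hδ : 0 < δ)
    (S : Fin (d + 1) → (Fin (d + 1) → ℤ) → MKer (d + 1) (Fib d)) (hSb : ∀ x z a b, ∃ M : ℝ, ∀ κ u, |S κ u x z a b| ≤ M)
    (μ : Fin (d + 1)) (y : Fin (d + 1) → ℤ) :
    vertexOfK (coDressKSymAt (toSite r) N K) N S μ y = vertexOfK K N (coProjSymAtK (toSite r) N S) μ y := by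
  funext x z a b
  obtain ⟨M, hM⟩ := hSb x z a b
  have hA : ∀ κ : Fin (d + 1), Summable (colH K N μ y κ) :=
    fun κ => AxialDressing.summable_col_of_decays hK hδ ((N : ℤ) • y) (Sum.inl κ) (Sum.inr μ)
  have h := sum_tsum_mul_coProjSymAt hN hr hA (g := fun κ u => S κ u x z a b) hM
  simp only [vertexOfK, wsum, coProjSymAtK, colH_coDressKSymAt_eq]
  exact h.symm

/-- [folklore] **PACK BRIDGE, SECOND ORDER, SYMMETRISED COMB** (inner then outer slot): for a decaying `K` and a `LocStencil₂` family,
`vertex2OfK (coDressKSymAt ρ N K) N S₂ μ y ν y′ = vertexOfK K N (coProjSymAtK ρ N (fun κ u => vertexOfK K N (coProjSymAtK ρ N (S₂ κ u)) ν y′)) μ y`. -/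
theorem vertex2OfK_coDressKSymAt_eq {K : MKer (d + 1) (Fib d)} {C δ : ℝ} (hK : Decays K C δ) (hC : 0 ≤ C) (hδ : 0 < δ)
    {S₂ : Fin (d + 1) → (Fin (d + 1) → ℤ) → Fin (d + 1) → (Fin (d + 1) → ℤ) → MKer (d + 1) (Fib d)} {C₂ δ₂ : ℝ}
    (hS₂ : LocStencil₂ S₂ C₂ δ₂) (hδ₂ : 0 < δ₂) (μ : Fin (d + 1)) (y : Fin (d + 1) → ℤ) (ν : Fin (d + 1)) (y' : Fin (d + 1) → ℤ) :
    vertex2OfK (coDressKSymAt (toSite r) N K) N S₂ μ y ν y'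
      = vertexOfK K N (coProjSymAtK (toSite r) N (fun κ u => vertexOfK K N (coProjSymAtK (toSite r) N (S₂ κ u)) ν y')) μ y := by
  have hin : ∀ κ u, vertexOfK (coDressKSymAt (toSite r) N K) N (S₂ κ u) ν y' = vertexOfK K N (coProjSymAtK (toSite r) N (S₂ κ u)) ν y' :=
    fun κ u => vertexOfK_coDressKSymAt_eq hN hr hK hδ (S₂ κ u) (fun x z a b => bdd_of_locStencil₂ hS₂ hδ₂.le κ u x z a b) ν y'
  have e : (fun κ u => vertexOfK K N (coProjSymAtK (toSite r) N (S₂ κ u)) ν y')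
      = fun κ u => vertexOfK (coDressKSymAt (toSite r) N K) N (S₂ κ u) ν y' := funext fun κ => funext fun u => (hin κ u).symm
  unfold vertex2OfK
  rw [e]
  refine vertexOfK_coDressKSymAt_eq hN hr hK hδ _ (fun x z a b => ?_) μ y
  obtain ⟨δG, CG, hδG, hCG, hG⟩ := decays_coDressKSymAt hN hr ⟨δ, C, hδ, hC, hK⟩
  have hm : 0 < min δG δ₂ := lt_min hδG hδ₂
  have hG' : Decays (coDressKSymAt (toSite r) N K) (|CG|) (min δG δ₂) := decays_of_le hG (min_le_left _ _)
  have hS₂' : LocStencil₂ S₂ C₂ (min δG δ₂) := fun κ u κ' u' w w' a' b' => by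
    refine (hS₂ κ u κ' u' w w' a' b').trans ?_
    have hC₂ := hS₂.nonneg
    rw [mul_assoc, mul_assoc, ← Real.exp_add, ← Real.exp_add]
    refine mul_le_mul_of_nonneg_left (Real.exp_le_exp.2 ?_) hC₂
    have := min_le_right δG δ₂
    nlinarith [l1_nonneg (u' - u), l1_nonneg (w - u), l1_nonneg (w' - u)]
  refine ⟨(d + 1 : ℕ) * (|CG| * C₂ * Zl (d + 1) (min δG δ₂ / 2)), fun κ u => ?_⟩
  have h := biLoc_vertexOfK_slice (N := N) hG' (abs_nonneg _) hS₂' hm κ u ν y' x z a b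
  refine h.trans ?_
  have hZ := Zl_nonneg (D := d + 1) (half_pos hm)
  have hC₂ := hS₂.nonneg
  have h1 : Real.exp (-(min δG δ₂ / 2) * l1 (u - (N : ℤ) • y')) ≤ 1 := Real.exp_le_one_iff.2 (by nlinarith [l1_nonneg (u - (N : ℤ) • y')])
  have h2 : Real.exp (-(min δG δ₂) * (l1 (x - u) + l1 (z - u))) ≤ 1 := Real.exp_le_one_iff.2 (by nlinarith [l1_nonneg (x - u), l1_nonneg (z - u)])
  calc (d + 1 : ℕ) * (|CG| * C₂ * Zl (d + 1) (min δG δ₂ / 2) * Real.exp (-(min δG δ₂ / 2) * l1 (u - (N : ℤ) • y')))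
        * Real.exp (-(min δG δ₂) * (l1 (x - u) + l1 (z - u)))
      ≤ (d + 1 : ℕ) * (|CG| * C₂ * Zl (d + 1) (min δG δ₂ / 2) * 1) * 1 :=
        mul_le_mul (mul_le_mul_of_nonneg_left (mul_le_mul_of_nonneg_left h1 (by positivity)) (by positivity)) h2 (Real.exp_pos _).le
          (by positivity)
    _ = (d + 1 : ℕ) * (|CG| * C₂ * Zl (d + 1) (min δG δ₂ / 2)) := by ring

omit hN hr in
/-- [folklore] **`Π̂ᵀ_sbm` ON THE OUTER INDEX COMMUTES WITH THE INNER CHAIN-RULE VERTEX** (any root `ρ`; two-bond family entrywise bounded uniformly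
in both bonds). -/
theorem coProjSymAtK_vertexOfK_comm (ρ : Fin (d + 1) → ℤ) {K : MKer (d + 1) (Fib d)} {C δ : ℝ} (hK : Decays K C δ) (hδ : 0 < δ)
    (T : Fin (d + 1) → (Fin (d + 1) → ℤ) → Fin (d + 1) → (Fin (d + 1) → ℤ) → MKer (d + 1) (Fib d))
    (hTb : ∀ x z a b, ∃ M : ℝ, ∀ κ₀ u₀ κ' u', |T κ₀ u₀ κ' u' x z a b| ≤ M) (ν : Fin (d + 1)) (y' : Fin (d + 1) → ℤ) :
    coProjSymAtK ρ N (fun κ u => vertexOfK K N (T κ u) ν y')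
      = fun κ u => vertexOfK K N (fun κ' u' => coProjSymAtK ρ N (fun κ₀ u₀ => T κ₀ u₀ κ' u') κ u) ν y' := by
  funext κ u x z a b
  obtain ⟨M, hM⟩ := hTb x z a b
  have hA : ∀ κ' : Fin (d + 1), Summable (colH K N ν y' κ') :=
    fun κ' => AxialDressing.summable_col_of_decays hK hδ ((N : ℤ) • y') (Sum.inl κ') (Sum.inr ν)
  have hs : ∀ (β : Fin (d + 1)) (w : Fin (d + 1) → ℤ) (κ' : Fin (d + 1)),
      Summable fun u' => colH K N ν y' κ' u' * T β w κ' u' x z a b := by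
    intro β w κ'
    refine Summable.of_norm_bounded (((hA κ').abs).mul_right |M|) (fun u' => ?_)
    rw [Real.norm_eq_abs, abs_mul]
    exact mul_le_mul_of_nonneg_left ((hM β w κ' u').trans (le_abs_self M)) (abs_nonneg _)
  show (∑ v ∈ cube (d + 1) N, ∑ β : Fin (d + 1), pmSymBm ρ N β (u + v) κ u
          * ∑ κ' : Fin (d + 1), ∑' u' : Fin (d + 1) → ℤ, colH K N ν y' κ' u' * T β (u + v) κ' u' x z a b)
      = ∑ κ' : Fin (d + 1), ∑' u' : Fin (d + 1) → ℤ, colH K N ν y' κ' u'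
          * ∑ v ∈ cube (d + 1) N, ∑ β : Fin (d + 1), pmSymBm ρ N β (u + v) κ u * T β (u + v) κ' u' x z a b
  have hR : ∀ κ' : Fin (d + 1), (∑' u' : Fin (d + 1) → ℤ, colH K N ν y' κ' u'
        * ∑ v ∈ cube (d + 1) N, ∑ β : Fin (d + 1), pmSymBm ρ N β (u + v) κ u * T β (u + v) κ' u' x z a b)
      = ∑ v ∈ cube (d + 1) N, ∑ β : Fin (d + 1), pmSymBm ρ N β (u + v) κ u
          * ∑' u' : Fin (d + 1) → ℤ, colH K N ν y' κ' u' * T β (u + v) κ' u' x z a b := by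
    intro κ'
    have e : ∀ u' : Fin (d + 1) → ℤ, colH K N ν y' κ' u'
          * ∑ v ∈ cube (d + 1) N, ∑ β : Fin (d + 1), pmSymBm ρ N β (u + v) κ u * T β (u + v) κ' u' x z a b
        = ∑ v ∈ cube (d + 1) N, ∑ β : Fin (d + 1), pmSymBm ρ N β (u + v) κ u * (colH K N ν y' κ' u' * T β (u + v) κ' u' x z a b) := by
      intro u'
      rw [Finset.mul_sum]
      refine Finset.sum_congr rfl fun v _ => ?_
      rw [Finset.mul_sum]
      exact Finset.sum_congr rfl fun β _ => by ring
    simp_rw [e]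
    rw [Summable.tsum_finsetSum (fun v _ => summable_sum fun β _ => (hs β (u + v) κ').mul_left _)]
    refine Finset.sum_congr rfl fun v _ => ?_
    rw [Summable.tsum_finsetSum (fun β _ => (hs β (u + v) κ').mul_left _)]
    exact Finset.sum_congr rfl fun β _ => tsum_mul_left
  simp_rw [hR]
  symm
  rw [Finset.sum_comm]
  refine Finset.sum_congr rfl fun v _ => ?_
  rw [Finset.sum_comm]
  refine Finset.sum_congr rfl fun β _ => ?_
  exact (Finset.mul_sum _ _ _).symm

/-- [folklore] **THE BI-VERTEX THROUGH A `Π̂ᵀ_sbm`-DRESSED RESOLVENT, FULLY DRESSED FORM**: for a decaying `K` and a `LocStencil₂` pair family,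
`vertex2OfK (coDressKSymAt ρ N K) N S₂ = vertex2OfK K N S₂^{Π̂Π̂}`, `S₂^{Π̂Π̂} κ u κ′ u′ := Π̂ᵀ_sbm^{outer} (κ₀ u₀ ↦ Π̂ᵀ_sbm (S₂ κ₀ u₀) κ′ u′) κ u`. -/
theorem vertex2OfK_coDressKSymAt_eq_full {K : MKer (d + 1) (Fib d)} {C δ : ℝ} (hK : Decays K C δ) (hC : 0 ≤ C) (hδ : 0 < δ)
    {S₂ : Fin (d + 1) → (Fin (d + 1) → ℤ) → Fin (d + 1) → (Fin (d + 1) → ℤ) → MKer (d + 1) (Fib d)} {C₂ δ₂ : ℝ}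
    (hS₂ : LocStencil₂ S₂ C₂ δ₂) (hδ₂ : 0 < δ₂) (μ : Fin (d + 1)) (y : Fin (d + 1) → ℤ) (ν : Fin (d + 1)) (y' : Fin (d + 1) → ℤ) :
    vertex2OfK (coDressKSymAt (toSite r) N K) N S₂ μ y ν y'
      = vertex2OfK K N (fun κ u κ' u' => coProjSymAtK (toSite r) N (fun κ₀ u₀ => coProjSymAtK (toSite r) N (S₂ κ₀ u₀) κ' u') κ u) μ y ν y' := by
  rw [vertex2OfK_coDressKSymAt_eq hN hr hK hC hδ hS₂ hδ₂ μ y ν y',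
    coProjSymAtK_vertexOfK_comm (N := N) (toSite r) hK hδ (fun κ u κ' u' => coProjSymAtK (toSite r) N (S₂ κ u) κ' u') (fun x z a b => ?_) ν y']
  · rfl
  · exact ⟨cWb d N * C₂, fun κ₀ u₀ κ' u' =>
      abs_coProjSymAt_le hN hr (fun κ₁ u₁ => S₂ κ₀ u₀ κ₁ u₁ x z a b) κ' u'
        (fun κ₁ v _ => abs_le_of_locStencil₂ hS₂ hδ₂.le κ₀ u₀ κ₁ (u' + v) x z a b)⟩

end Sym

end Summit.QuantumFields.BalabanUV.Beta.D1BFx.PackedDressingBridgeComb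

end
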